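import Summits.Parity.GeneralizedHardyLittlewood.Theorems.LiouvilleMADEngineToGHL
import Summits.Parity.GeneralizedHardyLittlewood.Theorems.LiouvilleShiftedTablesPairsToGHLPairSlice
import Summits.Parity.GeneralizedHardyLittlewood.Theorems.LeeYangFibresRelativeDimOneArchFactsAux
import Literature.NumberTheory.Sieve.LinearEquationsInPrimesMultiplicativity

/-!
# Route LiouvilleMAD — crux `EngineToGHL` (stmt-Parity-14995): tools for the reach of `PairsHL`

Lemmas for `LiouvilleMADEngineToGHLPairsReach.lean` (the exact reach of the hypothesis `PairsHL`
inside `DicksonFibration.DimOne`):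

* analytic: `abs_sub_le_linear_of_isLittleO` (`o(N)` ↦ `δ M + C` for every `M`) and the registered
  sub-goal `pairsHL_uniform_bound` (`PairsHL` ↦ one constant for all shifts `h ≤ H` and all `M`);
* one-dimensional geometry: `abs_card_filter_sub_volume_le_one` (integer points of a bounded interval
  vs. its length, within `1`), `filter_Icc_mem_eq_Icc` (they form a block), `sum_Icc_shift_eq`
  (block sums of `Λ(m+c)Λ(m+c+h)` as differences of the `PairsHL` partial sums);
* the unit-slope pair `(n + b₀, n + b₁)` in the Green–Tao dictionary: `vonMangoldtSum_unitSlopePair`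
  ((1.2) as a one-dimensional sum over the section of `K`), `archFactor_unitSlopePair`
  (`β_∞ = vol(section ∩ (-min bᵢ, ∞))`), `localFactor_unitSlopePair` / `singularProduct_unitSlopePair`
  (`∏_p β_p = 𝔖({0, |b₁ - b₀|})` by translation over `ℤ/qℤ`), `abs_const_le_of_affLinSize_le`
  (`‖Ψ‖_N ≤ L ⇒ |bᵢ| ≤ L N`);
* `block_arith`: the final `ε`-bookkeeping.

References: B. Green, T. Tao, *Linear equations in primes*, Ann. of Math. 171 (2010), (1.1)–(1.7),
Example 1 [GreenTao2010].
-/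

noncomputable section

namespace Summit.Parity.GeneralizedHardyLittlewood.Theorems.EngineToGHL

open Finset Filter MeasureTheory Literature.NumberTheory.Sieve
open scoped ArithmeticFunction.vonMangoldt Topology Classical
open Summit.Parity.GeneralizedHardyLittlewood.Theses
open Summit.Parity.GeneralizedHardyLittlewood.Theses.LiouvilleMAD
open Summit.Parity.GeneralizedHardyLittlewood.Cruxes.RelativeDimOne.TranslateAmplification
  (ordConnected_section section_subset_Icc volume_preimage_apply_zero card_shifts_bounds
    mem_iff_apply_zero_mem_section volume_ne_top_of_subset_Icc)

/-! ### Analytic input: from `o(N)` to a bound `δ M + C` valid for EVERY `M`, uniformly in `h ≤ H` -/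

/-- From `f(N) - 𝔖 N = o(N)`: for every `δ > 0` there is `C ≥ 0` with `|f(M) - 𝔖 M| ≤ δ M + C`
for ALL `M` (the finitely many `M` below the threshold are absorbed into `C`). [folklore] -/
theorem abs_sub_le_linear_of_isLittleO {f : ℕ → ℝ} {𝔖 : ℝ}
    (hf : (fun N : ℕ => f N - 𝔖 * N) =o[atTop] fun N : ℕ => (N : ℝ)) {δ : ℝ} (hδ : 0 < δ) :
    ∃ C : ℝ, 0 ≤ C ∧ ∀ M : ℕ, |f M - 𝔖 * M| ≤ δ * M + C := by
  obtain ⟨M₀, hM₀⟩ := eventually_atTop.mp (Asymptotics.isLittleO_iff.mp hf hδ)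
  have hsum0 : 0 ≤ ∑ M ∈ range M₀, |f M - 𝔖 * M| :=
    Finset.sum_nonneg fun M _ => abs_nonneg (f M - 𝔖 * M)
  refine ⟨∑ M ∈ range M₀, |f M - 𝔖 * M|, hsum0, fun M => ?_⟩
  by_cases hM : M₀ ≤ M
  · have h := hM₀ M hM
    rw [Real.norm_eq_abs, Real.norm_eq_abs, Nat.abs_cast] at h
    linarith
  · have hmem : M ∈ range M₀ := mem_range.mpr (not_le.mp hM)
    have h1 : |f M - 𝔖 * M| ≤ ∑ M ∈ range M₀, |f M - 𝔖 * M| :=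
      Finset.single_le_sum (fun M _ => abs_nonneg (f M - 𝔖 * M)) hmem
    have h2 : 0 ≤ δ * M := by positivity
    linarith

/-- `PairsHL` in the form used below: for every `H` and `δ > 0` one constant `C` such that
`|∑_{n ≤ M} Λ(n)Λ(n+h) - 𝔖({0,h}) M| ≤ δ M + C` for all `M` and all shifts `1 ≤ h ≤ H`.
[folklore] -/
theorem pairsHL_uniform_bound : LiouvilleShiftedTables.PairsHL → ∀ (H : ℕ) (δ : ℝ), 0 < δ → ∃ C : ℝ, 0 ≤ C ∧ ∀ h : ℕ, 1 ≤ h → h ≤ H → ∀ M : ℕ, |∑ n ∈ Icc 1 M, Λ n * Λ (n + h) - singularSeries ({0, (h : ℤ)} : Finset ℤ) * M| ≤ δ * M + C := by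
  intro hP H δ hδ
  have key : ∀ h : ℕ, ∃ C : ℝ, 0 ≤ C ∧ (1 ≤ h → ∀ M : ℕ,
      |∑ n ∈ Icc 1 M, Λ n * Λ (n + h) - singularSeries ({0, (h : ℤ)} : Finset ℤ) * M| ≤
        δ * M + C) := by
    intro h
    by_cases hh : 1 ≤ h
    · obtain ⟨C, hC0, hC⟩ := abs_sub_le_linear_of_isLittleO
        (f := fun M : ℕ => ∑ n ∈ Icc 1 M, Λ n * Λ (n + h)) (hP h hh) hδ
      exact ⟨C, hC0, fun _ => hC⟩
    · exact ⟨0, le_rfl, fun h' => absurd h' hh⟩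
  choose C hC0 hC using key
  refine ⟨∑ h ∈ Icc 1 H, C h, Finset.sum_nonneg fun h _ => hC0 h, fun h hh hhH M => ?_⟩
  have hle : C h ≤ ∑ h ∈ Icc 1 H, C h :=
    Finset.single_le_sum (fun h _ => hC0 h) (mem_Icc.mpr ⟨hh, hhH⟩)
  exact (hC h hh M).trans (by linarith)

/-! ### One-dimensional geometry: integer points of a bounded interval -/

/-- The number of integer points of an order-connected `J ⊆ [-N, N]` is within `1` of its length.
[folklore] -/
theorem abs_card_filter_sub_volume_le_one {J : Set ℝ} (hJ : J.OrdConnected) {N : ℕ}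
    (hJN : J ⊆ Set.Icc (-(N : ℝ)) N) :
    |(((Finset.Icc (-(N : ℤ)) N).filter (fun m : ℤ => (m : ℝ) ∈ J)).card : ℝ) -
        (volume J).toReal| ≤ 1 := by
  classical
  set T := (Finset.Icc (-(N : ℤ)) N).filter (fun m : ℤ => (m : ℝ) ∈ J) with hT
  rcases T.eq_empty_or_nonempty with hTe | ⟨m₀, hm₀⟩
  · -- no integer point: `J` sits strictly between two consecutive integers
    have hnoint : ∀ k : ℤ, (k : ℝ) ∈ J → False := by
      intro k hk
      have hkN := hJN hk
      rw [Set.mem_Icc] at hkN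
      have hkT : k ∈ T := by
        rw [hT, Finset.mem_filter, Finset.mem_Icc]
        exact ⟨⟨by exact_mod_cast hkN.1, by exact_mod_cast hkN.2⟩, hk⟩
      rw [hTe] at hkT
      simp at hkT
    have hvol : (volume J).toReal ≤ 1 := by
      rcases J.eq_empty_or_nonempty with hJe | ⟨y, hy⟩
      · simp [hJe]
      · have hsub : J ⊆ Set.Ioo (⌊y⌋ : ℝ) (⌊y⌋ + 1) := by
          intro z hz
          rw [Set.mem_Ioo]
          constructor
          · by_contra hcon
            exact hnoint ⌊y⌋ (hJ.out hz hy ⟨not_lt.mp hcon, Int.floor_le y⟩)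
          · by_contra hcon
            have h1 : y ≤ (⌊y⌋ : ℝ) + 1 := (Int.lt_floor_add_one y).le
            refine hnoint (⌊y⌋ + 1) ?_
            push_cast
            exact hJ.out hy hz ⟨h1, not_lt.mp hcon⟩
        have h1 : volume J ≤ ENNReal.ofReal 1 := by
          have h := measure_mono (μ := volume) hsub
          rw [Real.volume_Ioo] at h
          have h' : (⌊y⌋ : ℝ) + 1 - ⌊y⌋ = 1 := by ring
          rwa [h'] at h
        exact ENNReal.toReal_le_of_le_ofReal zero_le_one h1
    rw [hTe, Finset.card_empty, Nat.cast_zero, zero_sub, abs_neg,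
      abs_of_nonneg ENNReal.toReal_nonneg]
    exact hvol
  · -- `T` is a translate of the shift set of `card_shifts_bounds` at the integer point `m₀`
    have hm₀J : ((m₀ : ℤ) : ℝ) ∈ J := (Finset.mem_filter.mp hm₀).2
    have hm₀N := Finset.mem_Icc.mp (Finset.mem_filter.mp hm₀).1
    have hb := card_shifts_bounds hJ hJN hm₀J
    have hcard : ((Finset.Icc (-(2 * N : ℤ)) (2 * N)).filter
        (fun h : ℤ => (m₀ : ℝ) + (h : ℝ) ∈ J)).card = T.card := by
      refine Finset.card_nbij' (fun h => m₀ + h) (fun m => m - m₀) ?_ ?_ ?_ ?_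
      · intro h hh
        simp only [Finset.mem_coe, Finset.mem_filter] at hh
        have hJm := hh.2
        have hmN := hJN hJm
        rw [Set.mem_Icc] at hmN
        simp only [Finset.mem_coe, hT, Finset.mem_filter, Finset.mem_Icc]
        refine ⟨⟨?_, ?_⟩, by push_cast; exact hJm⟩
        · exact_mod_cast hmN.1
        · exact_mod_cast hmN.2
      · intro m hm
        simp only [Finset.mem_coe, hT, Finset.mem_filter, Finset.mem_Icc] at hm
        simp only [Finset.mem_coe, Finset.mem_filter, Finset.mem_Icc]
        refine ⟨⟨by omega, by omega⟩, ?_⟩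
        have : (m₀ : ℝ) + ((m - m₀ : ℤ) : ℝ) = (m : ℝ) := by push_cast; ring
        rw [this]
        exact hm.2
      · intro h _
        simp
      · intro m _
        simp
    rw [hcard] at hb
    rw [abs_le]
    constructor <;> linarith [hb.1, hb.2]

/-- The integer points of an order-connected set inside an integer interval form a block.
[folklore] -/
theorem filter_Icc_mem_eq_Icc {J : Set ℝ} (hJ : J.OrdConnected) {a b : ℤ}
    (hne : ((Finset.Icc a b).filter (fun m : ℤ => (m : ℝ) ∈ J)).Nonempty) :
    (Finset.Icc a b).filter (fun m : ℤ => (m : ℝ) ∈ J) =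
      Finset.Icc (((Finset.Icc a b).filter (fun m : ℤ => (m : ℝ) ∈ J)).min' hne)
        (((Finset.Icc a b).filter (fun m : ℤ => (m : ℝ) ∈ J)).max' hne) := by
  classical
  set T := (Finset.Icc a b).filter (fun m : ℤ => (m : ℝ) ∈ J) with hT
  ext m
  constructor
  · intro hm
    exact Finset.mem_Icc.mpr ⟨T.min'_le m hm, T.le_max' m hm⟩
  · intro hm
    rw [Finset.mem_Icc] at hm
    have hp := Finset.mem_filter.mp (T.min'_mem hne)
    have hq := Finset.mem_filter.mp (T.max'_mem hne)
    rw [Finset.mem_filter, Finset.mem_Icc]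
    refine ⟨⟨(Finset.mem_Icc.mp hp.1).1.trans hm.1, hm.2.trans (Finset.mem_Icc.mp hq.1).2⟩, ?_⟩
    exact hJ.out hp.2 hq.2 ⟨by exact_mod_cast hm.1, by exact_mod_cast hm.2⟩

/-- Partial-sum form of a block sum of `Λ(m + c) Λ(m + c + h)`:
`∑_{m=p}^{q} Λ(m+c)Λ(m+c+h) = S(q + c) - S(p + c - 1)` with `S(M) = ∑_{n ≤ M} Λ(n)Λ(n+h)`,
for `p ≤ q` and `p + c ≥ 1`. [folklore] -/
theorem sum_Icc_shift_eq (h : ℕ) {p q c : ℤ} (hpq : p ≤ q) (hpc : 1 ≤ p + c) :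
    ∑ m ∈ Finset.Icc p q, Λ ((m + c).toNat) * Λ ((m + c).toNat + h) =
      ∑ n ∈ Finset.Icc 1 (q + c).toNat, Λ n * Λ (n + h) -
        ∑ n ∈ Finset.Icc 1 ((p + c).toNat - 1), Λ n * Λ (n + h) := by
  have h1 : ∑ m ∈ Finset.Icc p q, Λ ((m + c).toNat) * Λ ((m + c).toNat + h) =
      ∑ n ∈ Finset.Icc (p + c).toNat (q + c).toNat, Λ n * Λ (n + h) := by
    refine Finset.sum_nbij' (fun m => (m + c).toNat) (fun n => (n : ℤ) - c) ?_ ?_ ?_ ?_ ?_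
    · intro m hm
      rw [Finset.mem_Icc] at hm ⊢
      omega
    · intro n hn
      rw [Finset.mem_Icc] at hn ⊢
      omega
    · intro m hm
      rw [Finset.mem_Icc] at hm
      omega
    · intro n hn
      rw [Finset.mem_Icc] at hn
      omega
    · intro m _
      rfl
  rw [h1, eq_sub_iff_add_eq, add_comm]
  have hsplit : Finset.Icc 1 (q + c).toNat =
      Finset.Icc 1 ((p + c).toNat - 1) ∪ Finset.Icc (p + c).toNat (q + c).toNat := by
    ext n
    simp only [Finset.mem_union, Finset.mem_Icc]
    omega
  rw [hsplit, Finset.sum_union]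
  rw [Finset.disjoint_left]
  intro n hn hn'
  simp only [Finset.mem_Icc] at hn hn'
  omega

/-! ### The unit-slope pair `(n + b₀, n + b₁)` in the Green–Tao dictionary -/

/-- `ψ(n) = n + b` for a form of slope `1` on `ℤ¹`. [cite: GreenTao2010, Def. 1.1] -/
theorem eval_unitSlope {ψ : AffLinForm 1} (hψ : ∀ j, ψ.coeff j = 1) (n : Fin 1 → ℤ) :
    ψ.eval n = n 0 + ψ.const := by
  simp [AffLinForm.eval, hψ]

/-- `ψ(x) = x + b` on `ℝ¹`. [cite: GreenTao2010, Def. 1.1] -/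
theorem realEval_unitSlope {ψ : AffLinForm 1} (hψ : ∀ j, ψ.coeff j = 1) (x : Fin 1 → ℝ) :
    ψ.realEval x = x 0 + ψ.const := by
  simp [AffLinForm.realEval, hψ]

/-- A product of the SAME weight over the pair `(m + b₀, m + b₁)` is the product over
`(m + min, m + max)`. [folklore] -/
theorem mul_pair_eq_mul_min_max {R : Type*} [CommMonoid R] (f : ℤ → R) (m b₀ b₁ : ℤ) :
    f (m + b₀) * f (m + b₁) = f (m + min b₀ b₁) * f (m + max b₀ b₁) := by
  rcases le_total b₀ b₁ with h | h
  · rw [min_eq_left h, max_eq_right h]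
  · rw [min_eq_right h, max_eq_left h, mul_comm]

/-- A filtered sum over `{0,…}^1 = piFinset` in dimension `1` is a filtered sum over the single
coordinate. [folklore] -/
theorem sum_filter_piFinset_const_fin_one {α M : Type*} [AddCommMonoid M] (s : Finset α)
    (P : (Fin 1 → α) → Prop) [DecidablePred P] (f : (Fin 1 → α) → M) :
    ∑ n ∈ (Fintype.piFinset fun _ : Fin 1 => s).filter P, f n =
      ∑ m ∈ s.filter (fun m => P (fun _ => m)), f (fun _ => m) := by
  rw [Finset.sum_filter, Finset.sum_filter, sum_piFinset_const_fin_one]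

/-- The weighted sum (1.2) of a unit-slope pair over a convex `K ⊆ [-N, N]` is the one-dimensional
sum of `Λ(m + b₀)Λ(m + b₁)` over the integer points `m` of the section of `K`.
[cite: GreenTao2010, (1.2)] -/
theorem vonMangoldtSum_unitSlopePair (Ψ : Fin 2 → AffLinForm 1) (hΨ : ∀ i j, (Ψ i).coeff j = 1)
    (K : Set (Fin 1 → ℝ)) (N : ℕ) (J : Set ℝ) (hJ : ∀ y : ℝ, y ∈ J ↔ (fun _ : Fin 1 => y) ∈ K) :
    vonMangoldtSum Ψ K N =
      ∑ m ∈ (Finset.Icc (-(N : ℤ)) N).filter (fun m : ℤ => (m : ℝ) ∈ J),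
        Λ ((m + (Ψ 0).const).toNat) * Λ ((m + (Ψ 1).const).toNat) := by
  classical
  unfold vonMangoldtSum latticeBox
  rw [sum_filter_piFinset_const_fin_one]
  refine Finset.sum_congr ?_ fun m _ => ?_
  · refine Finset.filter_congr fun m _ => ?_
    rw [hJ]
    rfl
  · simp only [Fin.prod_univ_two, intVonMangoldt, eval_unitSlope (hΨ 0), eval_unitSlope (hΨ 1)]

/-- The archimedean factor (1.4) of a unit-slope pair: `β_∞ = vol{y ∈ section of K : y > -min(b₀,b₁)}`.
[cite: GreenTao2010, (1.4)] -/
theorem archFactor_unitSlopePair (Ψ : Fin 2 → AffLinForm 1) (hΨ : ∀ i j, (Ψ i).coeff j = 1)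
    (K : Set (Fin 1 → ℝ)) (J : Set ℝ) (hJ : ∀ y : ℝ, y ∈ J ↔ (fun _ : Fin 1 => y) ∈ K) :
    archFactor Ψ K =
      (volume (J ∩ Set.Ioi (-((min (Ψ 0).const (Ψ 1).const : ℤ) : ℝ)))).toReal := by
  unfold archFactor
  rw [← volume_preimage_apply_zero]
  congr 2
  ext x
  have hx : x ∈ K ↔ x 0 ∈ J := by
    rw [mem_iff_apply_zero_mem_section K x, Set.mem_setOf_eq, hJ]
  simp only [Set.mem_inter_iff, Set.mem_preimage, Set.mem_setOf_eq, Set.mem_Ioi, Fin.forall_fin_two,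
    realEval_unitSlope (hΨ 0), realEval_unitSlope (hΨ 1), Int.cast_min, hx]
  constructor
  · rintro ⟨hK, h0, h1⟩
    refine ⟨hK, ?_⟩
    rcases le_total ((Ψ 0).const : ℝ) ((Ψ 1).const : ℝ) with h | h
    · rw [min_eq_left h]; linarith
    · rw [min_eq_right h]; linarith
  · rintro ⟨hK, hmin⟩
    refine ⟨hK, ?_, ?_⟩
    · linarith [min_le_left ((Ψ 0).const : ℝ) ((Ψ 1).const : ℝ)]
    · linarith [min_le_right ((Ψ 0).const : ℝ) ((Ψ 1).const : ℝ)]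

/-- The local factors (1.6) of a unit-slope pair are those of the shift pair `(n, n + h)`,
`h = max(b₀,b₁) - min(b₀,b₁)` (translate by `min`, average over `ℤ/qℤ`).
[cite: GreenTao2010, (1.6)] -/
theorem localFactor_unitSlopePair (Ψ : Fin 2 → AffLinForm 1) (hΨ : ∀ i j, (Ψ i).coeff j = 1)
    (q : ℕ) [NeZero q] :
    localFactor Ψ q =
      localFactor (shiftPairSystem (max (Ψ 0).const (Ψ 1).const - min (Ψ 0).const (Ψ 1).const)) q := by
  rw [localFactor_eq_sum_zmod, localFactor_eq_sum_zmod]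
  congr 1
  refine Fintype.sum_equiv (Equiv.addRight fun _ : Fin 1 => ((min (Ψ 0).const (Ψ 1).const : ℤ) : ZMod q))
    _ _ fun v => ?_
  simp only [Equiv.coe_addRight, Pi.add_apply, Fin.prod_univ_two, AffLinForm.modEval,
    Fin.sum_univ_one, hΨ, shiftPairSystem, Matrix.cons_val_zero, Matrix.cons_val_one,
    Int.cast_one, one_mul, Int.cast_zero, add_zero]
  have key := mul_pair_eq_mul_min_max (fun z : ℤ => localVonMangoldtZMod q (v 0 + (z : ZMod q)))
    0 (Ψ 0).const (Ψ 1).const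
  simp only [zero_add] at key
  rw [key]
  congr 2
  push_cast
  ring

/-- The singular product (1.7) of a unit-slope pair equals the Hardy–Littlewood singular series
`𝔖({0, h})`, `h = |b₁ - b₀| ≠ 0`. [cite: GreenTao2010, (1.7) and Example 1] -/
theorem singularProduct_unitSlopePair (Ψ : Fin 2 → AffLinForm 1) (hΨ : ∀ i j, (Ψ i).coeff j = 1)
    {h : ℕ} (hh : h ≠ 0) (hhe : (h : ℤ) = max (Ψ 0).const (Ψ 1).const - min (Ψ 0).const (Ψ 1).const) :
    singularProduct Ψ = singularSeries ({0, (h : ℤ)} : Finset ℤ) := by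
  rw [PairsToGHL.singularSeries_pair_eq_singularProduct hh]
  unfold singularProduct
  congr 1
  funext x
  unfold singularProductPartial
  refine Finset.prod_congr rfl fun p hp => ?_
  haveI : NeZero p := ⟨(Nat.mem_primesLE.mp hp).2.ne_zero⟩
  rw [localFactor_unitSlopePair Ψ hΨ p, hhe]

/-- Size bound: `‖Ψ‖_N ≤ L` forces `|bᵢ| ≤ L N`. [cite: GreenTao2010, (1.1)] -/
theorem abs_const_le_of_affLinSize_le {t d : ℕ} {Ψ : Fin t → AffLinForm d} {L N : ℕ}
    (hN : 0 < N) (hL : affLinSize Ψ N ≤ L) (i : Fin t) : |((Ψ i).const : ℝ)| ≤ L * N := by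
  have hN' : (0 : ℝ) < N := by exact_mod_cast hN
  have h1 : |((Ψ i).const : ℝ) / N| ≤ ∑ i, |((Ψ i).const : ℝ) / N| :=
    Finset.single_le_sum (f := fun i => |((Ψ i).const : ℝ) / N|) (fun i _ => abs_nonneg _)
      (Finset.mem_univ i)
  have h2 : 0 ≤ ∑ i, ∑ j, |((Ψ i).coeff j : ℝ)| :=
    Finset.sum_nonneg fun i _ => Finset.sum_nonneg fun j _ => abs_nonneg _
  have h3 : |((Ψ i).const : ℝ) / N| ≤ L := by
    unfold affLinSize at hL
    linarith
  rw [abs_div, Nat.abs_cast, div_le_iff₀ hN'] at h3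
  exact h3


/-- The final bookkeeping of `pairsReach_of_pairsHL`, isolated: two partial-sum errors
`δ·(end) + C`, the singular series against the `≤ 1` discrepancy between lattice count and length,
and the choice `δ = ε / (4(L+2))`, `2C + 𝔖s ≤ ε N / 2`. [folklore] -/
theorem block_arith {SB SA 𝔖 V δ C 𝔖s ε A B N L d : ℝ}
    (hSB : |SB - 𝔖 * B| ≤ δ * B + C) (hSA : |SA - 𝔖 * A| ≤ δ * A + C) (h𝔖 : |𝔖| ≤ 𝔖s)
    (hV : |d - V| ≤ 1) (hd : d = B - A) (hAB : A ≤ B) (hB : B ≤ (L + 1) * N)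
    (hNC : 2 * C + 𝔖s ≤ ε / 2 * N) (hδ : ε / (4 * (L + 2)) = δ) (hε : 0 < ε) (hN : 0 < N)
    (hL : 0 ≤ L) (h𝔖s0 : 0 ≤ 𝔖s) : |SB - SA - V * 𝔖| ≤ ε * N := by
  have hL2 : 0 < L + 2 := by linarith
  have hδ0 : 0 < δ := by rw [← hδ]; positivity
  have key : SB - SA - V * 𝔖 = (SB - 𝔖 * B) - (SA - 𝔖 * A) + 𝔖 * (d - V) := by
    rw [hd]; ring
  rw [key]
  have t1 : |(SB - 𝔖 * B) - (SA - 𝔖 * A) + 𝔖 * (d - V)| ≤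
      |(SB - 𝔖 * B) - (SA - 𝔖 * A)| + |𝔖 * (d - V)| := abs_add_le _ _
  have t2 : |(SB - 𝔖 * B) - (SA - 𝔖 * A)| ≤ |SB - 𝔖 * B| + |SA - 𝔖 * A| := abs_sub _ _
  have t3 : |𝔖 * (d - V)| ≤ 𝔖s * 1 := by
    rw [abs_mul]
    exact mul_le_mul h𝔖 hV (abs_nonneg _) h𝔖s0
  have hB' : δ * B ≤ δ * ((L + 1) * N) := mul_le_mul_of_nonneg_left hB hδ0.le
  have hA' : δ * A ≤ δ * ((L + 1) * N) := mul_le_mul_of_nonneg_left (hAB.trans hB) hδ0.le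
  have h2 : δ * ((L + 1) * N) = ε / 4 * N * ((L + 1) / (L + 2)) := by
    rw [← hδ]
    field_simp
  have h3 : (L + 1) / (L + 2) ≤ 1 := by
    rw [div_le_one hL2]
    linarith
  have h4 : ε / 4 * N * ((L + 1) / (L + 2)) ≤ ε / 4 * N :=
    mul_le_of_le_one_right (by positivity) h3
  have hεN : 0 < ε * N := mul_pos hε hN
  linarith

end Summit.Parity.GeneralizedHardyLittlewood.Theorems.EngineToGHL

end
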